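import Mathlib
import Summits.ValiantsHypothesis.ValiantsHypothesis.Theorems.BarrierLeverPartitionMinorsHitByVPHiddenStatesCoStarLeaves

/-!
# Route BarrierLever — item `PartitionMinorsHitByVP` (stmt-ValiantsHypothesis-19717), line `hidden-states`:
# THE CUBE-FLAG DESIGN — `t` nested cube pieces ⊔ stars, a legal wide design of size `2^h − c` (bookkeeping for the flag cells)

Helper file (`--supports stmt-ValiantsHypothesis-19717`; cell valiant-natproofs, rung V4, 𝒟-side door (c), registered line
`Cruxes/PartitionMinorsHitByVP/Lines/hidden_states.lean` v7; prover seat val-np-p6 gen 11). Definition-free; closes NO item.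

THE DESIGN `𝔉(h, t, n)`: `m = 2h` pieces and `K = h³` states; piece `p < t` is the FULL CUBE on the first `h − 1 − p` states (all their subsets are
members); piece `p ≥ t` is a STAR with `n p` points (the empty set and the singletons `{q}`, `q + 1 < n p`; no member if `n p = 0`). With the
weights below («0 on cube states, 1 on star states, 2 elsewhere; offset 2 on empty stars») the members are exactly the pairs of weight `< 2`, so
the design is a legal STRICT threshold join family. Size `(2^h − 2^{h−t}) + Σ_p n p`.

* `exists_distribution` — any `N ≤ (m − t)·L` free points can be distributed over the pieces `p ≥ t` with at most `L` each.
* `sum_pow_flag` — `Σ_{p<t} 2^{h−1−p} = 2^h − 2^{h−t}`.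
* `flag_weight_lt_two_iff` — the weight-`< 2` pairs are exactly the cube members and the star points.
* `flag_design` — an injective legal enumeration `e : Fin r → Fin (h+h) × Finset (Fin (h·h·h))` of them, `r = (2^h − 2^{h−t}) + Σ n p`.

Used by `…HiddenStatesFlagCells` (the lower node at the top `≈ 4 log₂ h` sizes of every `h`). WHAT THIS IS NOT: nothing on crux 14610 or VP ≠ VNP.
-/

set_option linter.dupNamespace false

namespace Summit.ValiantsHypothesis.ValiantsHypothesis.Theorems.BarrierLever.HiddenStates

open Finset

noncomputable section

namespace FlagCells

/-! ## 1. Arithmetic -/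

/-- Distributing `N ≤ (m − t)·L` points over the indices `p ≥ t` of `Fin m`, at most `L` each. -/
theorem exists_distribution (t L : ℕ) : ∀ (m N : ℕ), N ≤ (m - t) * L →
    ∃ n : Fin m → ℕ, (∀ p : Fin m, (p : ℕ) < t → n p = 0) ∧ (∀ p, n p ≤ L) ∧ ∑ p, n p = N := by
  intro m
  induction m with
  | zero =>
    intro N hN
    refine ⟨fun p => p.elim0, fun p => p.elim0, fun p => p.elim0, ?_⟩
    have hN0 : N = 0 := by simpa using hN
    simp [hN0]
  | succ m ih =>
    intro N hN
    by_cases htm : t ≤ m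
    · -- the new index `m` is a star index
      by_cases hle : N ≤ (m - t) * L
      · obtain ⟨n, hn0, hnL, hsum⟩ := ih N hle
        refine ⟨Fin.snoc n 0, fun p hp => ?_, fun p => ?_, ?_⟩
        · induction p using Fin.lastCases with
          | last => simp
          | cast j => rw [Fin.snoc_castSucc]; exact hn0 j (by simpa using hp)
        · induction p using Fin.lastCases with
          | last => simp
          | cast j => rw [Fin.snoc_castSucc]; exact hnL j
        · rw [Fin.sum_univ_castSucc]; simp [hsum]
      · push Not at hle
        obtain ⟨n, hn0, hnL, hsum⟩ := ih ((m - t) * L) le_rfl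
        have hmt : m + 1 - t = (m - t) + 1 := by omega
        rw [hmt, Nat.succ_mul] at hN
        refine ⟨Fin.snoc n (N - (m - t) * L), fun p hp => ?_, fun p => ?_, ?_⟩
        · induction p using Fin.lastCases with
          | last => simp at hp; omega
          | cast j => rw [Fin.snoc_castSucc]; exact hn0 j (by simpa using hp)
        · induction p using Fin.lastCases with
          | last => simp; omega
          | cast j => rw [Fin.snoc_castSucc]; exact hnL j
        · rw [Fin.sum_univ_castSucc]; simp [hsum]; omega
    · -- no star index at all: `N = 0`
      have hN0 : N = 0 := by
        have : m + 1 - t = 0 := by omega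
        rw [this, zero_mul] at hN; omega
      refine ⟨fun _ => 0, fun _ _ => rfl, fun _ => Nat.zero_le _, by simp [hN0]⟩

/-- `Σ_{p<t} 2^{h−1−p} = 2^h − 2^{h−t}` for `t ≤ h`. -/
theorem sum_pow_flag (h : ℕ) : ∀ t, t ≤ h → ∑ p ∈ Finset.range t, 2 ^ (h - 1 - p) = 2 ^ h - 2 ^ (h - t) := by
  intro t
  induction t with
  | zero => intro _; simp
  | succ t ih =>
    intro ht
    rw [Finset.sum_range_succ, ih (by omega)]
    have h1 : 2 ^ (h - t) = 2 * 2 ^ (h - 1 - t) := by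
      rw [← pow_succ']; congr 1; omega
    have h2 : 2 ^ (h - (t + 1)) = 2 ^ (h - 1 - t) := by congr 1; omega
    have h3 : 2 ^ (h - t) ≤ 2 ^ h := Nat.pow_le_pow_right (by norm_num) (by omega)
    omega

/-! ## 2. The weights and the member set -/

/-- **The members of the flag design are the weight-`< 2` pairs.** Piece `p < t`: the subsets of the first `h − 1 − p` states; piece `p ≥ t`:
the empty set (if `1 ≤ n p`) and the singletons `{q}` with `q + 1 < n p`. -/
theorem flag_weight_lt_two_iff (h t K : ℕ) (n : Fin (h + h) → ℕ) (x : Fin (h + h) × Finset (Fin K)) :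
    (if ((x.1 : ℕ) < t ∨ 1 ≤ n x.1) then 0 else 2) +
        ∑ q ∈ x.2, (if (x.1 : ℕ) < t then (if (q : ℕ) < h - 1 - x.1 then 0 else 2) else (if (q : ℕ) + 1 < n x.1 then 1 else 2)) < 2 ↔
      ((x.1 : ℕ) < t ∧ ∀ q ∈ x.2, (q : ℕ) < h - 1 - x.1) ∨
        (t ≤ (x.1 : ℕ) ∧ ((x.2 = ∅ ∧ 1 ≤ n x.1) ∨ ∃ q, x.2 = {q} ∧ (q : ℕ) + 1 < n x.1)) := by
  classical
  obtain ⟨p, J⟩ := x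
  simp only
  by_cases hp : (p : ℕ) < t
  · simp only [hp, true_or, if_true, zero_add, true_and, not_le.mpr hp, false_and, or_false]
    constructor
    · intro hlt q hq
      by_contra hq'
      have : (2 : ℕ) ≤ ∑ q ∈ J, (if (q : ℕ) < h - 1 - p then 0 else 2) := by
        rw [← Finset.add_sum_erase J _ hq, if_neg hq']; omega
      omega
    · intro hall
      rw [Finset.sum_eq_zero fun q hq => if_pos (hall q hq)]; norm_num
  · simp only [hp, false_or, false_and, if_false, not_lt.mp hp, true_and]
    by_cases hn : 1 ≤ n p
    · rw [if_pos hn, zero_add]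
      constructor
      · intro hlt
        -- at most one element, and it is a light singleton
        have hcard : J.card ≤ 1 := by
          by_contra hc
          push Not at hc
          obtain ⟨a, ha, b, hb, hab⟩ := Finset.one_lt_card.mp hc
          have h1 : (1 : ℕ) ≤ (if (a : ℕ) + 1 < n p then 1 else 2) := by split_ifs <;> omega
          have h2 : (1 : ℕ) ≤ (if (b : ℕ) + 1 < n p then 1 else 2) := by split_ifs <;> omega
          have : (if (a : ℕ) + 1 < n p then 1 else 2) + (if (b : ℕ) + 1 < n p then 1 else 2) ≤
              ∑ q ∈ J, (if (q : ℕ) + 1 < n p then 1 else 2) := by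
            rw [← Finset.add_sum_erase J _ ha, ← Finset.add_sum_erase (J.erase a) _ (Finset.mem_erase.mpr ⟨hab.symm, hb⟩)]
            omega
          omega
        by_cases hJ : J = ∅
        · exact Or.inl ⟨hJ, hn⟩
        · right
          obtain ⟨q, hq⟩ := Finset.nonempty_iff_ne_empty.mpr hJ
          have hJq : J = {q} :=
            Finset.eq_singleton_iff_unique_mem.mpr ⟨hq, fun y hy => Finset.card_le_one.mp hcard y hy q hq⟩
          refine ⟨q, hJq, ?_⟩
          rw [hJq, Finset.sum_singleton] at hlt
          by_contra hq'
          rw [if_neg hq'] at hlt; omega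
      · rintro (⟨rfl, -⟩ | ⟨q, rfl, hq⟩)
        · simp
        · rw [Finset.sum_singleton, if_pos hq]; norm_num
    · rw [if_neg hn]
      constructor
      · intro hlt; omega
      · rintro (⟨-, h1⟩ | ⟨q, -, hq⟩)
        · exact absurd h1 hn
        · omega

/-! ## 3. The design -/

/-- **The cube-flag design exists, is injective, legal, and has the stated members.** -/
theorem flag_design (h t : ℕ) (ht : t ≤ h) (n : Fin (h + h) → ℕ) (hn0 : ∀ p : Fin (h + h), (p : ℕ) < t → n p = 0)
    (hnL : ∀ p, n p ≤ h * h * h + 1) (r : ℕ) (hr : r = (2 ^ h - 2 ^ (h - t)) + ∑ p, n p) :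
    ∃ e : Fin r → Fin (h + h) × Finset (Fin (h * h * h)), Function.Injective e ∧
      (∀ x : Fin (h + h) × Finset (Fin (h * h * h)), x ∉ Set.range e →
        ∀ i, (fun p : Fin (h + h) => if ((p : ℕ) < t ∨ 1 ≤ n p) then 0 else 2) (e i).1 +
            ∑ k ∈ (e i).2, (fun (p : Fin (h + h)) (q : Fin (h * h * h)) =>
              if (p : ℕ) < t then (if (q : ℕ) < h - 1 - p then 0 else 2) else (if (q : ℕ) + 1 < n p then 1 else 2)) (e i).1 k <
          (fun p : Fin (h + h) => if ((p : ℕ) < t ∨ 1 ≤ n p) then 0 else 2) x.1 +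
            ∑ k ∈ x.2, (fun (p : Fin (h + h)) (q : Fin (h * h * h)) =>
              if (p : ℕ) < t then (if (q : ℕ) < h - 1 - p then 0 else 2) else (if (q : ℕ) + 1 < n p then 1 else 2)) x.1 k) ∧
      (∀ x : Fin (h + h) × Finset (Fin (h * h * h)), x ∈ Set.range e ↔
        ((x.1 : ℕ) < t ∧ ∀ q ∈ x.2, (q : ℕ) < h - 1 - x.1) ∨
          (t ≤ (x.1 : ℕ) ∧ ((x.2 = ∅ ∧ 1 ≤ n x.1) ∨ ∃ q, x.2 = {q} ∧ (q : ℕ) + 1 < n x.1))) := by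
  classical
  set K := h * h * h with hK
  -- the weight
  let wgt : Fin (h + h) × Finset (Fin K) → ℕ := fun x =>
    (if ((x.1 : ℕ) < t ∨ 1 ≤ n x.1) then 0 else 2) +
      ∑ q ∈ x.2, (if (x.1 : ℕ) < t then (if (q : ℕ) < h - 1 - x.1 then 0 else 2) else (if (q : ℕ) + 1 < n x.1 then 1 else 2))
  have hwgt : ∀ x, wgt x < 2 ↔ ((x.1 : ℕ) < t ∧ ∀ q ∈ x.2, (q : ℕ) < h - 1 - x.1) ∨
      (t ≤ (x.1 : ℕ) ∧ ((x.2 = ∅ ∧ 1 ≤ n x.1) ∨ ∃ q, x.2 = {q} ∧ (q : ℕ) + 1 < n x.1)) :=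
    fun x => flag_weight_lt_two_iff h t K n x
  set M : Finset (Fin (h + h) × Finset (Fin K)) := Finset.univ.filter fun x => wgt x < 2 with hM
  -- the fibres of `M`
  have hfib : ∀ p : Fin (h + h), (M.filter fun x => x.1 = p).card =
      (if (p : ℕ) < t then 2 ^ (h - 1 - p) else n p) := by
    intro p
    -- the fibre is the image of a family of state sets
    let Mp : Finset (Finset (Fin K)) :=
      if (p : ℕ) < t then (Finset.univ.filter fun q : Fin K => (q : ℕ) < h - 1 - p).powerset
      else (if 1 ≤ n p then {∅} else ∅) ∪ (Finset.univ.filter fun q : Fin K => (q : ℕ) + 1 < n p).image fun q => {q}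
    have hMp : ∀ J, J ∈ Mp ↔ wgt (p, J) < 2 := by
      intro J
      rw [hwgt]
      simp only [Mp]
      by_cases hp : (p : ℕ) < t
      · simp only [hp, if_true, Finset.mem_powerset, true_and, not_le.mpr hp, false_and, or_false]
        constructor
        · intro hJ q hq; exact (Finset.mem_filter.mp (hJ hq)).2
        · intro hJ q hq; exact Finset.mem_filter.mpr ⟨Finset.mem_univ _, hJ q hq⟩
      · simp only [hp, if_false, false_and, false_or, not_lt.mp hp, true_and, Finset.mem_union, Finset.mem_image,
          Finset.mem_filter, Finset.mem_univ]
        constructor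
        · rintro (hJ | ⟨q, hq, rfl⟩)
          · by_cases hn : 1 ≤ n p
            · rw [if_pos hn, Finset.mem_singleton] at hJ; exact Or.inl ⟨hJ, hn⟩
            · rw [if_neg hn] at hJ; exact absurd hJ (Finset.notMem_empty _)
          · exact Or.inr ⟨q, rfl, hq⟩
        · rintro (⟨rfl, hn⟩ | ⟨q, rfl, hq⟩)
          · left; rw [if_pos hn]; exact Finset.mem_singleton_self _
          · right; exact ⟨q, hq, rfl⟩
    have himg : (M.filter fun x => x.1 = p) = Mp.image fun J => (p, J) := by
      ext ⟨p', J⟩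
      simp only [hM, Finset.mem_filter, Finset.mem_univ, true_and, Finset.mem_image, Prod.mk.injEq]
      constructor
      · rintro ⟨hw, rfl⟩; exact ⟨J, (hMp J).mpr hw, rfl, rfl⟩
      · rintro ⟨J', hJ', rfl, rfl⟩; exact ⟨(hMp J').mp hJ', rfl⟩
    rw [himg, Finset.card_image_of_injective _ (fun J J' hJJ => (Prod.mk.injEq _ _ _ _).mp hJJ |>.2)]
    simp only [Mp]
    by_cases hp : (p : ℕ) < t
    · rw [if_pos hp, if_pos hp, Finset.card_powerset]
      congr 1
      have hle : h - 1 - p ≤ K := by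
        have : h ≤ h * h * h := le_trans (Nat.le_mul_of_pos_right h (by omega)) (Nat.le_mul_of_pos_right _ (by omega))
        omega
      rw [Fin.card_filter_val_lt, min_eq_right hle]
    · rw [if_neg hp, if_neg hp]
      have hdisj : Disjoint (if 1 ≤ n p then ({∅} : Finset (Finset (Fin K))) else ∅)
          ((Finset.univ.filter fun q : Fin K => (q : ℕ) + 1 < n p).image fun q => {q}) := by
        rw [Finset.disjoint_left]
        intro J hJ hJ'
        obtain ⟨q, -, rfl⟩ := Finset.mem_image.mp hJ'
        split_ifs at hJ
        · rw [Finset.mem_singleton] at hJ; exact Finset.singleton_ne_empty q hJ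
        · exact Finset.notMem_empty _ hJ
      rw [Finset.card_union_of_disjoint hdisj, Finset.card_image_of_injective _ Finset.singleton_injective]
      have hle : n p - 1 ≤ K := by have := hnL p; omega
      have hf : (Finset.univ.filter fun q : Fin K => (q : ℕ) + 1 < n p) = Finset.univ.filter fun q : Fin K => (q : ℕ) < n p - 1 := by
        ext q; simp only [Finset.mem_filter, Finset.mem_univ, true_and]; omega
      rw [hf, Fin.card_filter_val_lt, min_eq_right hle]
      split_ifs with h1
      · rw [Finset.card_singleton]; omega
      · rw [Finset.card_empty]; omega
  -- the size of `M`
  -- Σ_{p<t} 2^{h-1-p} over `Fin (h+h)`, and the star sum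
  have hsum : ∑ p ∈ Finset.univ.filter (fun p : Fin (h + h) => (p : ℕ) < t), 2 ^ (h - 1 - (p : ℕ)) =
      ∑ p ∈ Finset.range t, 2 ^ (h - 1 - p) := by
    apply Finset.sum_bij (fun (p : Fin (h + h)) _ => (p : ℕ))
    · intro p hp; exact Finset.mem_range.mpr (Finset.mem_filter.mp hp).2
    · intro p _ p' _ hpp; exact Fin.ext hpp
    · intro j hj
      exact ⟨⟨j, by have := Finset.mem_range.mp hj; omega⟩, Finset.mem_filter.mpr ⟨Finset.mem_univ _, Finset.mem_range.mp hj⟩, rfl⟩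
    · intro p _; rfl
  have hsum_n : ∑ p ∈ Finset.univ.filter (fun p : Fin (h + h) => ¬ (p : ℕ) < t), n p = ∑ p, n p := by
    rw [Finset.sum_filter]
    refine Finset.sum_congr rfl fun p _ => ?_
    by_cases hp : (p : ℕ) < t
    · rw [if_neg (not_not.mpr hp), hn0 p hp]
    · rw [if_pos hp]
  have hMcard : M.card = r := by
    rw [Finset.card_eq_sum_card_fiberwise (f := Prod.fst) (t := Finset.univ) (fun x _ => Finset.mem_univ _),
      Finset.sum_congr rfl fun p _ => hfib p, Finset.sum_ite, hsum, hsum_n, sum_pow_flag h t ht, hr]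
  -- the enumeration
  let ε : {x // x ∈ M} ≃ Fin r := M.equivFin.trans (finCongr hMcard)
  let e : Fin r → Fin (h + h) × Finset (Fin K) := fun k => (ε.symm k).1
  have he : Function.Injective e := fun k k' hkk => ε.symm.injective (Subtype.ext hkk)
  have hrange : ∀ x, x ∈ Set.range e ↔ wgt x < 2 := by
    intro x
    constructor
    · rintro ⟨k, rfl⟩
      exact (Finset.mem_filter.mp (ε.symm k).2).2
    · intro hx
      have hxM : x ∈ M := Finset.mem_filter.mpr ⟨Finset.mem_univ _, hx⟩
      exact ⟨ε ⟨x, hxM⟩, by simp [e]⟩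
  refine ⟨e, he, ?_, fun x => (hrange x).trans (hwgt x)⟩
  intro x hx i
  have h1 : wgt (e i) < 2 := (hrange _).mp ⟨i, rfl⟩
  have h2 : ¬ wgt x < 2 := fun hh => hx ((hrange x).mpr hh)
  show wgt (e i) < wgt x
  omega

end FlagCells

end

end Summit.ValiantsHypothesis.ValiantsHypothesis.Theorems.BarrierLever.HiddenStates
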